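import Summits.PneNP.PneNP.Theorems.OneSliceConstantBandDefs
import Literature.Computability.Complexity.CliqueThresholdBounds
import Summits.PneNP.PneNP.Theorems.OneSliceConstantBandNearCliqueContiguityMoment
import Summits.PneNP.PneNP.Theorems.OneSliceConstantBandNearCliqueContiguityFibres
import Summits.PneNP.PneNP.Theorems.OneSliceConstantBandNearCliqueContiguityWindow

/-!
# Near-clique contiguity on a critical slice: S2 of the line `flat-prior-relative-minterms` (crux `stmt-PneNP-2834`)

`stub_nearCliqueContiguity` (definitionally `NearCliqueContiguity`): for `k ≥ 3`, any width `w` and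
`ε > 0`, eventually in `n`, for every central `j`, every band slice `i` and every event `S`,
`P_{(x,A,e)}[x ∪ (K_A − e) ∈ S] ≤ P_{y ∼ G(n, i + C(k,2) − 1)}[y ∈ S] + ε`.

Proof: split the triples `(x, A, e)` along the overlap event `on(x) ∩ K_A ≠ ∅` (probability
`≤ K·i/C(n,2) → 0`); off it the planting map is injective into the pattern fibres of `y = x ∪ (K_A − e)`,
of sizes `X(y) = #{(A,e) : K_A − e ⊆ on(y), e ∉ on(y)}`; the second moment of `X` on the slice
`i + K - 1` is `(1 + o(1))·(first moment)²/#slice` (strict balance of `K_k`: every proper sub-pattern is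
supercritical at the `k`-clique threshold), so `Σ_{y ∈ S} X(y) ≤ E[X]·(#S + o(#slice))` by Cauchy–Schwarz.
Parts 1–5: `…NearCliqueContiguity{Count,Pairs,Moment,Fibres,Window}.lean`. [folklore]
-/

noncomputable section
namespace Summit.PneNP.PneNP.Cruxes.ConstantBand.FlatPriorRelativeMinterms

set_option linter.dupNamespace false

open Literature.Computability.Complexity Filter Classical
open Finset hiding slice
open Summit.PneNP.PneNP.Theorems.ConstantBand.Negative
open scoped Topology

section Main

set_option quotPrecheck false

variable {n : ℕ}

/-- The `k`-subsets of the vertex set. -/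
local notation "𝒜⟦" n ", " k "⟧" => powersetCard k (univ : Finset (Fin n))

/-- The admissible pairs `(A, e)`: a `k`-set `A` and an edge `e` of `K_A`. -/
local notation "𝒫⟦" n ", " k "⟧" =>
  Finset.filter (fun ae : Finset (Fin n) × Edge n => ae.2 ∈ edgesIn ae.1)
    ((powersetCard k (univ : Finset (Fin n))) ×ˢ (univ : Finset (Edge n)))

/-- The pattern of `(A, e)` in `y`: `K_A − e ⊆ on(y)` and `e ∉ on(y)`. -/
local notation "Pat⟦" A ", " e ", " y "⟧" =>
  ((∀ e' ∈ edgesIn A, e' ≠ e → y e' = true) ∧ y e = false)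

/-- The near-clique count `X(y) = #{(A,e) : K_A − e ⊆ on(y), e ∉ on(y)}`. -/
local notation "Xc⟦" n ", " k ", " y "⟧" =>
  Finset.card (Finset.filter (fun ae : Finset (Fin n) × Edge n => Pat⟦ae.1, ae.2, y⟧) 𝒫⟦n, k⟧)

/-- The threshold density `θ_k(n) = n^{-2/(k-1)}`. -/
local notation "θ⟦" k ", " n "⟧" => ((n : ℝ) ^ (-(2 : ℝ) / ((k : ℝ) - 1)))

/-- The real threshold `T_k(n) = C(n,2)·θ_k(n)` (`thr k n = ⌊T_k(n)⌋₊`). -/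
local notation "T⟦" k ", " n "⟧" => (((Nat.choose n 2 : ℕ) : ℝ) * θ⟦k, n⟧)

/-- Membership in a filter, with the decidability instance as a unification-only argument (the unfolded
`tripleProb`/`sliceProb` carry classical instances). [folklore] -/
theorem ncc_mem_filter_iff {α : Type*} {p : α → Prop} {inst : DecidablePred p} {s : Finset α} {a : α} :
    a ∈ @Finset.filter α p inst s ↔ a ∈ s ∧ p a :=
  @Finset.mem_filter α p inst s a

/-- **The fibres of planting**: off the overlap event, `(x, A, e) ↦ (x ∪ (K_A − e), A, e)` is injective,
lands in the slice `i + K - 1` and in the pattern `K_A − e ⊆ on(y), e ∉ on(y)`; hence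
`#{(x,A,e) : no overlap, x ∪ (K_A − e) ∈ S} ≤ Σ_{y ∈ S ∩ slice_{i+K-1}} X(y)`. [folklore] -/
theorem ncc_rest_le (k i : ℕ) (S : Finset (Edge n → Bool)) :
    #((((slice n i) ×ˢ 𝒜⟦n, k⟧) ×ˢ (univ : Finset (Edge n))).filter fun t =>
        t.2 ∈ edgesIn t.1.2 ∧ plantSub t.1.2 t.2 t.1.1 ∈ S ∧ ¬ ∃ e' ∈ edgesIn t.1.2, t.1.1 e' = true) ≤
      ∑ y ∈ (slice n (i + k.choose 2 - 1)).filter (· ∈ S), Xc⟦n, k, y⟧ := by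
  have hprod := ncc_card_filter_product' ((slice n (i + k.choose 2 - 1)).filter (· ∈ S)) 𝒫⟦n, k⟧
    (fun q : (Edge n → Bool) × (Finset (Fin n) × Edge n) => Pat⟦q.2.1, q.2.2, q.1⟧)
  refine le_trans ?_ (le_of_eq (hprod.trans rfl))
  refine card_le_card_of_injOn (fun t => (plantSub t.1.2 t.2 t.1.1, (t.1.2, t.2))) (fun t ht => ?_)
    (fun t₁ ht₁ t₂ ht₂ h => ?_)
  · rw [mem_coe, mem_filter, mem_product, mem_product] at ht
    obtain ⟨⟨⟨hx, hA⟩, -⟩, he, hS, hno⟩ := ht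
    push Not at hno
    have hK : #(edgesIn t.1.2) = k.choose 2 := by rw [ncc_edgesIn_eq_filter, card_filter_cliqueVec, (mem_powersetCard.1 hA).2]
    have hK1 : 1 ≤ k.choose 2 := by rw [← hK]; exact card_pos.2 ⟨_, he⟩
    rw [mem_coe, mem_filter, mem_product, mem_filter, mem_filter, mem_product]
    refine ⟨⟨⟨?_, hS⟩, ⟨hA, mem_univ _⟩, he⟩, ?_, ?_⟩
    · -- the planted vector lies on the slice `i + K - 1`
      rw [slice, mem_filter] at hx ⊢
      refine ⟨mem_univ _, ?_⟩
      have hU : ((univ : Finset (Edge n)).filter fun f => plantSub t.1.2 t.2 t.1.1 f = true) =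
          ((univ : Finset (Edge n)).filter fun f => t.1.1 f = true) ∪ (edgesIn t.1.2).erase t.2 := by
        ext f
        simp only [plantSub, mem_union, mem_filter, mem_univ, true_and, mem_erase, ncc_mem_edgesIn,
          Bool.or_eq_true, Bool.and_eq_true, decide_eq_true_eq]
        tauto
      have hD : Disjoint ((univ : Finset (Edge n)).filter fun f => t.1.1 f = true)
          ((edgesIn t.1.2).erase t.2) :=
        disjoint_left.2 fun f hf hf' => hno f (mem_erase.1 hf').2 (mem_filter.1 hf).2
      have hc := hx.2
      rw [edgeCount] at hc ⊢
      rw [hU, card_union_of_disjoint hD, hc, card_erase_of_mem he, hK]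
      omega
    · intro e' he' hne
      simp [plantSub, (ncc_mem_edgesIn _ e').1 he', hne]
    · have hxe : t.1.1 t.2 = false := by simpa using hno t.2 he
      simp [plantSub, hxe]
  · simp only [Prod.mk.injEq] at h
    obtain ⟨hps, hA, he⟩ := h
    rw [mem_coe, mem_filter] at ht₁ ht₂
    have hno₁ := ht₁.2.2.2
    have hno₂ := ht₂.2.2.2
    push Not at hno₁ hno₂
    refine Prod.ext (Prod.ext ?_ hA) he
    funext f
    have hf := congrFun hps f
    by_cases hfA : f ∈ edgesIn t₁.1.2
    · have h1 : t₁.1.1 f = false := by simpa using hno₁ f hfA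
      have h2 : t₂.1.1 f = false := by simpa using hno₂ f (hA ▸ hfA)
      rw [h1, h2]
    · have hc : cliqueVec t₁.1.2 f = false := by
        simpa [ncc_mem_edgesIn] using hfA
      have hc2 : cliqueVec t₂.1.2 f = false := by rw [← hA]; exact hc
      simpa [plantSub, hc, hc2] using hf

set_option maxHeartbeats 400000 in
/-- **Near-clique contiguity at a good `n`** (all largeness conditions as explicit hypotheses): for central
`j`, a band slice `i` and any event `S`,
`P_{(x,A,e)}[x ∪ (K_A − e) ∈ S] ≤ P_{y ∼ G(n, i+K-1)}[y ∈ S] + ε`.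
Overlap (`on(x) ∩ K_A ≠ ∅`) costs `≤ K·i/C(n,2) ≤ ε/2`; off the overlap the planting map is injective
into the pattern fibres, whose sizes `X(y)` have `#slice·Σ X² ≤ (1 + ε²/4)(Σ X)²`, whence one-sided
total variation `≤ ε/2` by Cauchy–Schwarz. [folklore] -/
theorem ncc_main_at {k w n : ℕ} {ε : ℝ} (hk : 3 ≤ k) (hε : 0 < ε) (hn : 2 * k ≤ n)
    (hwin : T⟦k, n⟧ ^ ((3 : ℝ) / 4) + ((w : ℝ) + k.choose 2 + 2) ≤ T⟦k, n⟧ / 2)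
    (hθ4 : θ⟦k, n⟧ ≤ 1 / 4) (hθε : θ⟦k, n⟧ ≤ ε / (4 * k.choose 2))
    (hfac : 2 / ((n.choose k : ℝ) * k.choose 2 * (θ⟦k, n⟧ / 2) ^ (k.choose 2 - 1)) +
        ((n.choose 2 : ℝ) / (n.choose 2 + 1 - 2 * k.choose 2)) ^ k.choose 2 +
        4 * (∑ a ∈ Ico 2 k, (k.choose a : ℝ) * (n - k).choose (k - a) *
            (2 * θ⟦k, n⟧) ^ (2 * k.choose 2 - a.choose 2 - 2)) /
          ((n.choose k : ℝ) * (θ⟦k, n⟧ / 2) ^ (2 * k.choose 2 - 2)) ≤ 1 + (ε / 2) ^ 2)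
    {j : ℕ} (hj : Central k n j) {i : ℕ} (hi : i ∈ band j w) (S : Finset (Edge n → Bool)) :
    tripleProb n k i (fun x A e => plantSub A e x ∈ S) ≤
      sliceProb n (i + k.choose 2 - 1) (fun y => y ∈ S) + ε := by
  have hK3 : 3 ≤ k.choose 2 := (Nat.choose_le_choose 2 hk : Nat.choose 3 2 ≤ k.choose 2)
  have hKR : (3 : ℝ) ≤ k.choose 2 := by exact_mod_cast hK3
  have hn1 : 1 ≤ n := by omega
  have hkn : k ≤ n := by omega
  have hθpos : 0 < θ⟦k, n⟧ := Real.rpow_pos_of_pos (by exact_mod_cast hn1) _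
  have hT0 : 0 ≤ T⟦k, n⟧ := by positivity
  have hT34 : 0 ≤ T⟦k, n⟧ ^ ((3 : ℝ) / 4) := Real.rpow_nonneg hT0 _
  -- the window
  rw [band, mem_Icc] at hi
  have hup := ncc_window_up (k := k) (n := n) (w := w) hj hi.2
  have hlo := ncc_window_lo (k := k) (n := n) (w := w) (i := i) hj (by omega)
  have hi_lo : T⟦k, n⟧ / 2 + k.choose 2 + 1 ≤ i := by linarith
  have hmR : ((i + k.choose 2 - 1 : ℕ) : ℝ) = i + k.choose 2 - 1 := by
    rw [Nat.cast_sub (by omega), Nat.cast_add, Nat.cast_one]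
  have hm_hi : ((i + k.choose 2 - 1 : ℕ) : ℝ) ≤ 2 * T⟦k, n⟧ := by
    rw [hmR]
    linarith
  have h2m : 2 * (i + k.choose 2 - 1) ≤ n.choose 2 := by
    have : (2 * (i + k.choose 2 - 1 : ℕ) : ℝ) ≤ n.choose 2 := by
      calc (2 * (i + k.choose 2 - 1 : ℕ) : ℝ) ≤ 4 * T⟦k, n⟧ := by linarith
        _ = (n.choose 2 : ℝ) * (4 * θ⟦k, n⟧) := by ring
        _ ≤ (n.choose 2 : ℝ) * 1 := by gcongr; linarith
        _ = n.choose 2 := mul_one _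
    exact_mod_cast this
  have hKm : 2 * k.choose 2 ≤ i + k.choose 2 - 1 := by
    have : (2 * k.choose 2 : ℝ) ≤ ((i + k.choose 2 - 1 : ℕ) : ℝ) := by
      rw [hmR]
      linarith
    exact_mod_cast this
  have hiN : i ≤ n.choose 2 := by omega
  -- the second moment with `ℓ = θ/2`, `p = 2θ`, and the one-sided total variation
  have hmom := ncc_moment_bound (n := n) (m := i + k.choose 2 - 1) hk hkn h2m hKm
    (ℓ := θ⟦k, n⟧ / 2) (p := 2 * θ⟦k, n⟧) (by positivity) (by rw [hmR]; linarith)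
    (by linarith) (by linarith)
  have hδ0 : (0 : ℝ) ≤ ε / 2 := by positivity
  have hmom' := hmom.trans (mul_le_mul_of_nonneg_right hfac (sq_nonneg _))
  have htv := ncc_tv (s := slice n (i + k.choose 2 - 1))
    (S := (slice n (i + k.choose 2 - 1)).filter (· ∈ S)) (filter_subset _ _)
    (fun y => (Xc⟦n, k, y⟧ : ℝ)) (fun _ _ => Nat.cast_nonneg _) hδ0 hmom'
  -- the first moment and the triple denominator
  have hTot : (∑ y ∈ slice n (i + k.choose 2 - 1), (Xc⟦n, k, y⟧ : ℝ)) =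
      (n.choose k : ℝ) * k.choose 2 * ((n.choose 2 - k.choose 2).choose i : ℝ) := by
    have h := ncc_sum_X (n := n) (k := k) (m := i + k.choose 2 - 1) (by omega)
    rw [show i + k.choose 2 - 1 - (k.choose 2 - 1) = i by omega] at h
    exact_mod_cast h
  have hsl : #(slice n i) = (n.choose 2).choose i := ts_card_slice n i
  have hslpos : 0 < #(slice n i) := by rw [hsl]; exact Nat.choose_pos hiN
  have hC : 0 < n.choose k := Nat.choose_pos hkn
  have hD3pos : (0 : ℝ) < (#(slice n i) : ℝ) * (n.choose k : ℝ) * (k.choose 2 : ℝ) := by positivity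
  have hTotle : (n.choose k : ℝ) * k.choose 2 * ((n.choose 2 - k.choose 2).choose i : ℝ) ≤
      (#(slice n i) : ℝ) * (n.choose k : ℝ) * (k.choose 2 : ℝ) := by
    rw [hsl]
    have h1 : (n.choose 2 - k.choose 2).choose i ≤ (n.choose 2).choose i :=
      Nat.choose_le_choose i (Nat.sub_le _ _)
    have h2 : (((n.choose 2 - k.choose 2).choose i : ℕ) : ℝ) ≤ (n.choose 2).choose i := by exact_mod_cast h1
    calc (n.choose k : ℝ) * k.choose 2 * ((n.choose 2 - k.choose 2).choose i : ℝ)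
        ≤ (n.choose k : ℝ) * k.choose 2 * ((n.choose 2).choose i : ℝ) := by gcongr
      _ = _ := by ring
  -- overlap and fibres
  have hO := ncc_overlap_mul_le (n := n) k hiN
  have hR := ncc_rest_le (n := n) k i S
  -- the overlap fraction is `≤ ε/2`
  have hNpos : (0 : ℝ) < n.choose 2 := by exact_mod_cast (show 0 < n.choose 2 by omega)
  have hiθ : (i : ℝ) ≤ 2 * (n.choose 2 : ℝ) * θ⟦k, n⟧ := by
    have : (i : ℝ) ≤ ((i + k.choose 2 - 1 : ℕ) : ℝ) := by exact_mod_cast (show i ≤ i + k.choose 2 - 1 by omega)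
    linarith
  have hKθ : 2 * (k.choose 2 : ℝ) * θ⟦k, n⟧ ≤ ε / 2 := by
    have h := hθε
    rw [le_div_iff₀ (by positivity)] at h
    linarith
  -- reduce to explicit finsets (decidability-agnostic)
  suffices H : ∀ (TS : Finset (((Edge n → Bool) × Finset (Fin n)) × Edge n)) (SS : Finset (Edge n → Bool)),
      (∀ t, t ∈ TS ↔ t ∈ ((slice n i) ×ˢ 𝒜⟦n, k⟧) ×ˢ (univ : Finset (Edge n)) ∧
        (t.2 ∈ edgesIn t.1.2 ∧ plantSub t.1.2 t.2 t.1.1 ∈ S)) →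
      (∀ y, y ∈ SS ↔ y ∈ slice n (i + k.choose 2 - 1) ∧ y ∈ S) →
      (#TS : ℝ) / ((#(slice n i) : ℝ) * (n.choose k : ℝ) * (k.choose 2 : ℝ)) ≤
        (#SS : ℝ) / (#(slice n (i + k.choose 2 - 1)) : ℝ) + ε by
    dsimp only [tripleProb, sliceProb]
    exact H _ _ (fun t => ncc_mem_filter_iff) (fun y => ncc_mem_filter_iff)
  intro TS SS hTS hSS
  have hSSeq : SS = (slice n (i + k.choose 2 - 1)).filter (· ∈ S) := by
    ext y
    rw [hSS, mem_filter]
  -- split the triples along the overlap event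
  have hnum : #TS ≤
      #((((slice n i) ×ˢ 𝒜⟦n, k⟧) ×ˢ (univ : Finset (Edge n))).filter fun t =>
          t.2 ∈ edgesIn t.1.2 ∧ ∃ e' ∈ edgesIn t.1.2, t.1.1 e' = true) +
      #((((slice n i) ×ˢ 𝒜⟦n, k⟧) ×ˢ (univ : Finset (Edge n))).filter fun t =>
          t.2 ∈ edgesIn t.1.2 ∧ plantSub t.1.2 t.2 t.1.1 ∈ S ∧ ¬ ∃ e' ∈ edgesIn t.1.2, t.1.1 e' = true) := by
    rw [← card_filter_add_card_filter_not (s := TS) (fun t => ∃ e' ∈ edgesIn t.1.2, t.1.1 e' = true)]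
    apply add_le_add
    · refine card_le_card fun t ht => ?_
      rw [mem_filter, hTS] at ht
      rw [mem_filter]
      exact ⟨ht.1.1, ht.1.2.1, ht.2⟩
    · refine card_le_card fun t ht => ?_
      rw [mem_filter, hTS] at ht
      rw [mem_filter]
      exact ⟨ht.1.1, ht.1.2.1, ht.1.2.2, ht.2⟩
  -- real arithmetic
  have hOR : (#((((slice n i) ×ˢ 𝒜⟦n, k⟧) ×ˢ (univ : Finset (Edge n))).filter fun t =>
      t.2 ∈ edgesIn t.1.2 ∧ ∃ e' ∈ edgesIn t.1.2, t.1.1 e' = true) : ℝ) ≤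
      ε / 2 * ((#(slice n i) : ℝ) * (n.choose k : ℝ) * (k.choose 2 : ℝ)) := by
    have hO' : (#((((slice n i) ×ˢ 𝒜⟦n, k⟧) ×ˢ (univ : Finset (Edge n))).filter fun t =>
        t.2 ∈ edgesIn t.1.2 ∧ ∃ e' ∈ edgesIn t.1.2, t.1.1 e' = true) : ℝ) * n.choose 2 ≤
        (k.choose 2 : ℝ) * k.choose 2 * i * #(slice n i) * n.choose k := by exact_mod_cast hO
    refine le_of_mul_le_mul_right (hO'.trans ?_) hNpos
    calc (k.choose 2 : ℝ) * k.choose 2 * i * #(slice n i) * n.choose k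
        = ((k.choose 2 : ℝ) * k.choose 2 * #(slice n i) * n.choose k) * i := by ring
      _ ≤ ((k.choose 2 : ℝ) * k.choose 2 * #(slice n i) * n.choose k) * (2 * (n.choose 2 : ℝ) * θ⟦k, n⟧) :=
          mul_le_mul_of_nonneg_left hiθ (by positivity)
      _ = (2 * (k.choose 2 : ℝ) * θ⟦k, n⟧) * ((#(slice n i) : ℝ) * (n.choose k : ℝ) * (k.choose 2 : ℝ)) *
            n.choose 2 := by ring
      _ ≤ ε / 2 * ((#(slice n i) : ℝ) * (n.choose k : ℝ) * (k.choose 2 : ℝ)) * n.choose 2 := by gcongr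
  have hRR : (#((((slice n i) ×ˢ 𝒜⟦n, k⟧) ×ˢ (univ : Finset (Edge n))).filter fun t =>
      t.2 ∈ edgesIn t.1.2 ∧ plantSub t.1.2 t.2 t.1.1 ∈ S ∧ ¬ ∃ e' ∈ edgesIn t.1.2, t.1.1 e' = true) : ℝ) ≤
      ((#(slice n i) : ℝ) * (n.choose k : ℝ) * (k.choose 2 : ℝ)) *
        ((#SS : ℝ) / #(slice n (i + k.choose 2 - 1)) + ε / 2) := by
    have hR' : (#((((slice n i) ×ˢ 𝒜⟦n, k⟧) ×ˢ (univ : Finset (Edge n))).filter fun t =>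
        t.2 ∈ edgesIn t.1.2 ∧ plantSub t.1.2 t.2 t.1.1 ∈ S ∧ ¬ ∃ e' ∈ edgesIn t.1.2, t.1.1 e' = true) : ℝ) ≤
        ∑ y ∈ (slice n (i + k.choose 2 - 1)).filter (· ∈ S), (Xc⟦n, k, y⟧ : ℝ) := by exact_mod_cast hR
    refine hR'.trans (htv.trans ?_)
    rw [hTot, ← hSSeq]
    have hf0 : 0 ≤ (#SS : ℝ) / #(slice n (i + k.choose 2 - 1)) + ε / 2 := by positivity
    exact mul_le_mul_of_nonneg_right hTotle hf0
  have hnumR : (#TS : ℝ) ≤ ((#(slice n i) : ℝ) * (n.choose k : ℝ) * (k.choose 2 : ℝ)) *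
      ((#SS : ℝ) / #(slice n (i + k.choose 2 - 1)) + ε) := by
    have h1 := (Nat.cast_le (α := ℝ)).2 hnum
    push_cast at h1
    linarith [hOR, hRR]
  rw [div_le_iff₀ hD3pos]
  linarith [hnumR]

/-- **S2 · near-clique contiguity on the slice** (the registered stub, definitionally
`NearCliqueContiguity`): for `k ≥ 3`, any width `w` and `ε > 0`, eventually in `n`, for every central
`j`, every band slice `i ∈ [j-w, j+w]` and every event `S`,
`P_{(x,A,e)}[x ∪ (K_A − e) ∈ S] ≤ P_{y ∼ G(n, i + C(k,2) − 1)}[y ∈ S] + ε` — planting `K_k` minus one edge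
into a critical slice is invisible in one-sided total variation, because the near-clique count
`X(y) = #{(A,e) : K_A − e ⊆ y, e ∉ y}` has `Var X/(E X)² → 0` (every sub-pattern of `K_k^-` is
supercritical at `p = n^{-2/(k-1)}`). [folklore] -/
theorem stub_nearCliqueContiguity :
    ∀ k : ℕ, 3 ≤ k → ∀ w : ℕ, ∀ ε : ℝ, 0 < ε → ∀ᶠ n : ℕ in atTop, ∀ j : ℕ, Central k n j →
      ∀ i ∈ band j w, ∀ S : Finset (Edge n → Bool),
        tripleProb n k i (fun x A e => plantSub A e x ∈ S) ≤
          sliceProb n (i + k.choose 2 - 1) (fun y => y ∈ S) + ε := by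
  intro k hk w ε hε
  have hK : (0 : ℝ) < k.choose 2 := by exact_mod_cast Nat.choose_pos (by omega : 2 ≤ k)
  have hη : 0 < (ε / 2) ^ 2 / 3 := by positivity
  filter_upwards [eventually_ge_atTop (2 * k), ncc_eventually_window hk ((w : ℝ) + k.choose 2 + 2),
    ncc_eventually_θ_le hk (show (0 : ℝ) < 1 / 4 by norm_num),
    ncc_eventually_θ_le hk (show (0 : ℝ) < ε / (4 * k.choose 2) by positivity),
    ncc_eventually_E1 hk hη, ncc_eventually_ratio hk hη, ncc_eventually_E3 hk hη]
    with n hn hwin hθ4 hθε hE1 hR hE3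
  intro j hj i hi S
  exact ncc_main_at hk hε hn hwin hθ4 hθε (by linarith) hj hi S

end Main

end Summit.PneNP.PneNP.Cruxes.ConstantBand.FlatPriorRelativeMinterms

end
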